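import Summits.QuantumFields.YangMills.Theorems.FluctuationComparisonRegPrIntLS2BetaQTubeOfAxialAligned
import Summits.QuantumFields.YangMills.Theorems.FluctuationComparisonRegPrIntLS2BetaCombTransporterAxialT
import Summits.QuantumFields.YangMills.Theorems.FluctuationComparisonRegPrIntLS2BetaResidualSubgroup
import Summits.QuantumFields.YangMills.Theorems.FluctuationComparisonRegPrIntLS2BetaOneBondMoveSmall
import Summits.QuantumFields.YangMills.Theorems.UnitScaleTiltProp7AxialLemma1
import HarnessLib

/-!
# S2β · DET-REP (B) — CLOSE-AXIALLY-ALIGNED-MIN AT THE CARRIER: the axially aligned residual translate of a regular corner minimiser is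
# plaquette-small, aligned to the base in print's `axialT` currency, and within `113(ε₀+e₀) + β` of the base on EVERY bond (`β` = the coarse-data discrepancy)

Crux `stmt-QuantumFields-20520` (`…Theses.UnitScaleTilt.FluctuationComparisonRegPrIntL`), LINE g18-1 S2β, organ (C3) ∕ DET-REP (B), EDGE third, (Q-TUBE);
cell `ym3-torus` (HUMAN RULING D-0037 — rung R3: continuum `SU(2)` Yang–Mills on `T³`; NOT `d = 4`, NOT infinite volume, NOT a mass gap, NOT Clay); width seat
`ym3-torus-px13` g19; definition-free helper (`--kind proof --supports stmt-QuantumFields-20520 --as helper`, NOT a proof of the crux and NOT of any registered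
stub).  Theorems only: 0 `def`, 0 `instance`, 0 `notation`, 0 `sorry`; default heartbeats.  Imports px21 g17's FILE F `…S2BetaQTubeOfAxialAligned` (§4 only),
✓p790546 `…CombTransporterAxialT`, ✓`…S2BetaResidualSubgroup`, ✓p790469 `…S2BetaOneBondMoveSmall`, ✓`UnitScaleTiltProp7AxialLemma1`.

WHY.  ymfull-r3-prover-4 g0's chain reduces the EDGE third of `def DetRepB` (registry `Lines/semiclassical_s2beta.lean` v11.4 :1072–1098) at a non-base corner
`X` to the (Q-TUBE) letter, and ✓`…S2BetaQTubeOfAligned` (p790779) ∕ px21 g17's FILE F `…S2BetaQTubeOfAxialAligned` (the `hax` edition, fed by ✓p790546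
`…CombTransporterAxialT` §3) derive (Q-TUBE) — DEPTH-FREE — from **CLOSE-AXIALLY-ALIGNED-MIN**: «a residual translate `w′ • u` of the corner's minimiser
`u` is axially aligned to the base `U₀` (`∀ x, axialT (w′ • u) (rootOf k x) x = axialT U₀ (rootOf k x) x`, `k = K − J`), has plaquettes within
`ε₀·L^{−2k}` of `1`, and is within `t` of `U₀` on every free bond».  This file ASSEMBLES that letter at the d = 3 carrier from the ★19200-p1 lineage's
print-space files, BY NAME: the aligner with regularity kept ✓`UnitScaleTiltProp7AxialSpace18.exists_axial18` ([Balaban1985Variational] (18): the complete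
`k`-fold comb axial gauge inside the group (4)), made residual by ✓`…S2BetaResidualGauge.residual_of_descTransf_eq_one`, re-spelled at the centres by
✓`…CombTransporterAxialT.rootOf_eq_embIter_iterBlockOf`; and [Balaban1985RegularSpaces] Lemma 1 (1.24)–(1.25) with `α₁ ≠ 0` at the carrier, ALL bonds
(interior `O(ε₀η)` ∪ face `O(ε₀) + β`), ✓`UnitScaleTiltProp7AxialLemma1.norm_pertVar_le_of_combAxial_T3` (`L ≥ 7`, `50(500L + 7L²)·e ≤ 1`), whose
middle letter `hmid` — the discrepancy of the two `k`-fold (0.4)-averages — is read off the COARSE DATA: a history in the fibre of `X` averages to (the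
level-shifted) `X` (lit `descendTo` unfolded), so `hmid` ⟸ `∀ c′, dist1 (X c′·(X₀ c′)⁻¹) ≤ β`, and for window data agreeing off one coarse bond (the corners
of `DetRepB`'s quadrilateral) ✓p790469 (β3) `dist1_mul_inv_lt_of_agree_off_bond` gives `β := θ_X + θ₀`.

WHAT (every constant independent of `k = K − J` and of the volume).
* §1 `iter_eq_fieldShift_of_mem_fibre` (the `(K−J)`-fold (0.4)-average of a history over `X` IS `X`, level-shifted), ★`dist1_iter_mul_inv_le_of_data`
  (`hmid` from the data), ★`dist1_data_le_of_agree_off_bond` ((β3) packaged: data agreeing off one bond ⟹ `∀ c′, dist1 (X c′·(X₀ c′)⁻¹) ≤ θ_X + θ₀`),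
  `dist1_data_le_of_intermediate` ∕ ★`dist1_data_le_of_agree_off_two_bonds` (the far corner: through the adjacent one, `(θ_X + θ_V) + (θ_V + θ₀)`).
* §2 ★★★ `closeAxiallyAlignedMin_of_regular`: `L ≥ 7`, radii `ε₀, e₀` with `50(500L + 7L²)·e ≤ 1`, `u ∈ 𝔘_k(ε₀) ∩ 𝔅_k(X)` (`regFibrePr`), `U₀ ∈ 𝔅_k(X₀)` printed-regular
  at `e₀`, data `β`-close bondwise ⟹ `∃ w′ : residualSubgroup F hJK`, `w′ • u ∈ regFibrePr … ε₀ X` ∧ `PlaqSmall (regThreshold F J K ε₀) (w′ • u)` ∧ `hax` (rootOf spelling)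
  ∧ `∀ b, dist1 ((w′ • u) b·(U₀ b)⁻¹) ≤ 113(ε₀ + e₀) + β` — exactly the `(w′, hW, hax, hclose)` block of FILE F's `qTube_of_axialAligned_gaugeAct`, with `hU₀ :=
  RegPr.plaqSmall`; ★★ `closeAxiallyAlignedMin_of_regular_offBond` (the (β3) instance, `β := θ_X + θ₀`).
* §3 ★ `stokesSurcharge_le`: FILE F's threshold surcharge `2·(((F.P K).d·((F.P K).L^{K−J} − 1) : ℕ)²∕4)·(regThreshold ε₀ + regThreshold e₀) ≤ (9∕2)(ε₀ + e₀)` at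
  `d = 3` — so FILE F's three thresholds are met once `t₀ := (235∕2)(ε₀ + e₀) + β` is `< r_C`, `≤ ½`, `2t₀ < s_C∕2` (the organ's `ε₁`, `γ₁`); `threshold_le_of_stokesSurcharge`.
* §4 ★★★ `qTube_of_regularCorner` = FILE F's ★★★`qTube_of_axialAligned_gaugeAct` ∘ §2 ∘ §3: (Q-TUBE) `∃ k y, y ∈ UV ∧ pivotAct ι k (σ y) = u` for a REGULAR corner
  history `u` over `X`, the base `U₀` over `X₀` regular, data `β`-close, the cover row `hF6` of the tube of record, and the one number `t₀` below the thresholds;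
  ★★★ `cornerRows_text_of_regularCorner` = that ∘ ✓`cornerRows_text_of_pivotAct_eq` — the per-value corner rows of `EdgeRows` at `X`.
NET for the EDGE third of `def DetRepB` at a non-base corner (ymfull-r3-prover-4 g0's LOCATE-(β) ∕ FINDING-QTUBE-KINEMATIC, px21 g17's depth flag): the kinematic
letter CLOSE-(AXIALLY-)ALIGNED-MIN is DISCHARGED; what stays displayed is the tube of record's cover row (✓`exists_tubeRows_cover`), the window-chart rows, the
EXISTENCE of the regular minimising histories (EXW∘) and the base's regularity, the data closeness (`β := θ_X + θ₀` by §1 for the quadrilateral's corners), and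
`t₀ < r_C ∧ t₀ ≤ ½ ∧ 2t₀ < s_C∕2` — numbers, not estimates.

HONEST SCOPE.  A composition of landed theorems (group∕lattice bookkeeping, one unfolding of `descendTo`); nothing of [Balaban1985RegularSpaces] Thm 2, of the
existence of the minimisers (EXW∘), of DETN∕JACW, of DET-REP (B), GAP♯, S2β or the crux 20520 is proved; `L ≥ 7` and the radii smallness are inherited from
✓`…AxialGaugeFace` (the ★19200-p2 transport comparison); finite-volume∕conditional programme; `YM3TorusSU2` NOT proved; rung R3 = SU(2) YM₃ on T³ — NOT d = 4,
NOT infinite volume, NOT a mass gap, NOT Clay; the Yang–Mills mass gap is NOT proved.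

References: T. Bałaban, CMP 99 (1985) 75–102 [Balaban1985RegularSpaces] (Lemma 1 (1.24)–(1.26) p. 79, (1.19) p. 79); CMP 102 (1985) 277–309
[Balaban1985Variational] ((2)–(4), (6) p. 278, (14), (18) p. 280, Thm 1 (8)–(10) p. 279); CMP 98 (1985) 17–51 [Balaban1985Averaging] ((8)–(9) pp. 18–19, pp. 24–25);
CMP 109 (1987) 249–301 [Balaban1987RG1] ((0.11) p. 253, (0.18) p. 255).
-/

noncomputable section

open scoped Matrix.Norms.L2Operator
open Literature.MathematicalPhysics.QuantumFieldTheory.Balaban1983to89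
open T4Continuum BlockAveraging
open B10Eq27TorusAxialLog (axialT)
open B5Eq118OneStroke (iterBlockOf)
open B15DeterminingSets (embIter)
open T4RootedResidualGauge (rootOf)
open Literature.MathematicalPhysics.QuantumFieldTheory.Balaban1983to89.T3ContinuumYM3Torus
open Literature.MathematicalPhysics.QuantumFieldTheory.Balaban1983to89.T3LevelShift
open Literature.MathematicalPhysics.QuantumFieldTheory.Balaban1983to89.T3UnitLawDensityEML (ℰp)
open Literature.MathematicalPhysics.QuantumFieldTheory.Balaban1983to89.T3TiltDescent (descendTo)
open Literature.MathematicalPhysics.QuantumFieldTheory.Balaban1983to89.T3ConstrainedMinimiser (fibre)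
open Literature.MathematicalPhysics.QuantumFieldTheory.Balaban1983to89.T3RegularMinimiser (regThreshold)
open Literature.MathematicalPhysics.QuantumFieldTheory.Balaban1983to89.T3PrintedRegularMinimiser (RegPr RegPr.plaqSmall regFibrePr mem_regFibrePr_iff)
open Literature.MathematicalPhysics.QuantumFieldTheory.Balaban1983to89.T3PrintedRegularOrbits (descTransf)
open Literature.MathematicalPhysics.QuantumFieldTheory.Balaban1983to89.T3SectALandauChart (pos_of_regPr)
open BlockAveragingEMLLinearisedBackground (pertVar)
open Summit.QuantumFields.YangMills.Theorems.Prop7AxialSpace18 (exists_axial18)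
open Summit.QuantumFields.YangMills.Theorems.Prop7AxialLemma1 (norm_pertVar_le_of_combAxial_T3)
open Summit.QuantumFields.YangMills.Theorems.FluctuationComparisonRegPrIntLS2BetaResidualSubgroup (residualSubgroup)
open Summit.QuantumFields.YangMills.Theorems.FluctuationComparisonRegPrIntLS2BetaResidualGauge (residual_of_descTransf_eq_one)
open Summit.QuantumFields.YangMills.Theorems.FluctuationComparisonRegPrIntLS2BetaCombTransporterAxialT (rootOf_eq_embIter_iterBlockOf)
open Summit.QuantumFields.YangMills.Theorems.FluctuationComparisonRegPrIntLS2BetaOneBondMoveSmall (dist1_mul_inv_lt_of_agree_off_bond)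

namespace Summit.QuantumFields.YangMills.Theorems.FluctuationComparisonRegPrIntLS2BetaCloseAxiallyAlignedMin

variable (F : T3Family) {J K : ℕ} (hJK : J ≤ K)

/-! ## §1 The `(K−J)`-fold (0.4)-average of a history is its datum; `hmid` from the data; (β3) packaged -/

/-- **A HISTORY OVER `X` AVERAGES TO `X`**: for `W ∈ 𝔅_k(X)` (`descendTo F ℰp J K hJK W = X`) the `(K−J)`-fold (0.4)-average of `W` is `X` read on the
height-`(K−J)` lattice of run `K` (lit `descendTo` = `fieldShift ∘ Averaging.iter`, unfolded). [cite: Balaban1987RG1, (0.11) p.253; Balaban1985Variational, (3) p.278] -/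
theorem iter_eq_fieldShift_of_mem_fibre {X : GaugeField (F.P J) 0 (Matrix.specialUnitaryGroup (Fin 2) ℂ)}
    {W : GaugeField (F.P K) 0 (Matrix.specialUnitaryGroup (Fin 2) ℂ)} (hW : W ∈ fibre F ℰp J K hJK X) :
    Averaging.iter (fun j => blockAvg (P := F.P K) (j := j) (ExpMeanLog.expMeanLogSU (n := Fin 2))) (K - J) W =
      fieldShift (F.sitesPerDir_eq (m := F.m) (K := J) (j := 0) (m' := F.m) (K' := K) (j' := K - J) (by omega)).symm X := by
  have h1 : descendTo F ℰp J K hJK W = X := hW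
  unfold descendTo at h1
  have h2 := congrArg (fieldShift (G := Matrix.specialUnitaryGroup (Fin 2) ℂ)
    (F.sitesPerDir_eq (m := F.m) (K := J) (j := 0) (m' := F.m) (K' := K) (j' := K - J) (by omega)).symm) h1
  rwa [fieldShift_fieldShift_symm] at h2

/-- ★ **`hmid` FROM THE DATA**: two histories over `X`, `X₀` have `(K−J)`-fold (0.4)-averages exactly as far apart, bond by bond, as `X` and `X₀`; in particular
`∀ c′, dist1 (X c′·(X₀ c′)⁻¹) ≤ β` gives the middle letter `hmid` of ✓`UnitScaleTiltProp7AxialGaugeFace.dist1_mul_inv_le_face_T3` ∕ ✓`…AxialLemma1.norm_pertVar_le_of_combAxial_T3`.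
[cite: Balaban1985RegularSpaces, Lemma 1 (1.24) p.79; Balaban1987RG1, (0.11) p.253] -/
theorem dist1_iter_mul_inv_le_of_data {X X₀ : GaugeField (F.P J) 0 (Matrix.specialUnitaryGroup (Fin 2) ℂ)}
    {W U₀ : GaugeField (F.P K) 0 (Matrix.specialUnitaryGroup (Fin 2) ℂ)} (hW : W ∈ fibre F ℰp J K hJK X) (hU₀ : U₀ ∈ fibre F ℰp J K hJK X₀)
    {β : ℝ} (hXX₀ : ∀ c' : PBond (F.P J) 0, dist1 (X c' * (X₀ c')⁻¹) ≤ β) (c : PBond (F.P K) (K - J)) :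
    dist1 (Averaging.iter (fun j => blockAvg (P := F.P K) (j := j) (ExpMeanLog.expMeanLogSU (n := Fin 2))) (K - J) W c *
        (Averaging.iter (fun j => blockAvg (P := F.P K) (j := j) (ExpMeanLog.expMeanLogSU (n := Fin 2))) (K - J) U₀ c)⁻¹) ≤ β := by
  rw [iter_eq_fieldShift_of_mem_fibre F hJK hW, iter_eq_fieldShift_of_mem_fibre F hJK hU₀, fieldShift_apply, fieldShift_apply]
  exact hXX₀ _

/-- ★ **(β3) PACKAGED — TWO WINDOW DATA AGREEING OFF ONE BOND ARE BONDWISE `(θ_X + θ₀)`-CLOSE**: `PlaqSmall θ_X X`, `PlaqSmall θ₀ X₀`, `X e = X₀ e` for `e ≠ c₀`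
⟹ `∀ c′, dist1 (X c′·(X₀ c′)⁻¹) ≤ θ_X + θ₀` (at `c₀` by ✓p790469 `dist1_mul_inv_lt_of_agree_off_bond` through a plaquette in a second direction — `d = 3` has one —,
elsewhere the quotient is `1`). [cite: Balaban1987RG1, (0.18) p.255; Balaban1985Averaging, (9) p.19] -/
theorem dist1_data_le_of_agree_off_bond {θX θ₀ : ℝ} {X X₀ : GaugeField (F.P J) 0 (Matrix.specialUnitaryGroup (Fin 2) ℂ)}
    (hX : PlaqSmall θX X) (hX₀ : PlaqSmall θ₀ X₀) (c₀ : PBond (F.P J) 0) (hagree : ∀ e : PBond (F.P J) 0, e ≠ c₀ → X e = X₀ e)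
    (c' : PBond (F.P J) 0) : dist1 (X c' * (X₀ c')⁻¹) ≤ θX + θ₀ := by
  -- a second direction exists at `d = 3`
  obtain ⟨ν, hν⟩ : ∃ ν : Fin (F.P J).d, ν ≠ c₀.dir := by
    by_cases h0 : c₀.dir = ⟨0, by simp⟩
    · exact ⟨⟨1, by simp⟩, by rw [h0]; simp⟩
    · exact ⟨⟨0, by simp⟩, Ne.symm h0⟩
  have hc₀ : dist1 (X c₀ * (X₀ c₀)⁻¹) < θX + θ₀ := dist1_mul_inv_lt_of_agree_off_bond hX hX₀ c₀ ν hν hagree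
  by_cases hc : c' = c₀
  · rw [hc]; exact hc₀.le
  · rw [hagree c' hc, mul_inv_cancel, GaugeGroup.dist1_one]
    exact (GaugeGroup.dist1_nonneg _).trans hc₀.le

/-- ★ **DATA CLOSENESS THROUGH AN INTERMEDIATE DATUM** (for the far corner of `DetRepB`'s quadrilateral, which differs from the base at TWO coarse bonds: go through the
adjacent corner): `∀ c, dist1 (X c·(V c)⁻¹) ≤ β₁` and `∀ c, dist1 (V c·(X₀ c)⁻¹) ≤ β₂` ⟹ `∀ c, dist1 (X c·(X₀ c)⁻¹) ≤ β₁ + β₂` (insert `V c⁻¹·V c`; `dist1_mul_le`). [folklore] -/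
theorem dist1_data_le_of_intermediate {P : Params} {j : ℕ} {G : Type*} [GaugeGroup G] {X V X₀ : GaugeField P j G} {β₁ β₂ : ℝ}
    (hXV : ∀ c : PBond P j, dist1 (X c * (V c)⁻¹) ≤ β₁) (hVX₀ : ∀ c : PBond P j, dist1 (V c * (X₀ c)⁻¹) ≤ β₂) (c : PBond P j) :
    dist1 (X c * (X₀ c)⁻¹) ≤ β₁ + β₂ := by
  calc dist1 (X c * (X₀ c)⁻¹) = dist1 ((X c * (V c)⁻¹) * (V c * (X₀ c)⁻¹)) := by congr 1; group
    _ ≤ dist1 (X c * (V c)⁻¹) + dist1 (V c * (X₀ c)⁻¹) := GaugeGroup.dist1_mul_le _ _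
    _ ≤ β₁ + β₂ := add_le_add (hXV c) (hVX₀ c)

/-- ★ **TWO WINDOW DATA AGREEING OFF TWO BONDS, THROUGH THE ADJACENT CORNER**: `X` agrees with `V` off `c₁`, `V` agrees with `X₀` off `c₀`, all three plaquette-small ⟹
`∀ c′, dist1 (X c′·(X₀ c′)⁻¹) ≤ (θ_X + θ_V) + (θ_V + θ₀)`. [cite: Balaban1987RG1, (0.18) p.255; Balaban1985Averaging, (9) p.19] -/
theorem dist1_data_le_of_agree_off_two_bonds {θX θV θ₀ : ℝ} {X V X₀ : GaugeField (F.P J) 0 (Matrix.specialUnitaryGroup (Fin 2) ℂ)}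
    (hX : PlaqSmall θX X) (hV : PlaqSmall θV V) (hX₀ : PlaqSmall θ₀ X₀) (c₁ c₀ : PBond (F.P J) 0)
    (hXV : ∀ e : PBond (F.P J) 0, e ≠ c₁ → X e = V e) (hVX₀ : ∀ e : PBond (F.P J) 0, e ≠ c₀ → V e = X₀ e)
    (c' : PBond (F.P J) 0) : dist1 (X c' * (X₀ c')⁻¹) ≤ (θX + θV) + (θV + θ₀) :=
  dist1_data_le_of_intermediate (dist1_data_le_of_agree_off_bond F hX hV c₁ hXV) (dist1_data_le_of_agree_off_bond F hV hX₀ c₀ hVX₀) c'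

/-! ## §2 CLOSE-AXIALLY-ALIGNED-MIN at the carrier -/

/-- ★★★ **CLOSE-AXIALLY-ALIGNED-MIN AT THE CARRIER.**  Block size `L ≥ 7`; radii `ε₀, e₀` with `50(500L + 7L²)·e ≤ 1`; `u ∈ 𝔘_k(ε₀) ∩ 𝔅_k(X)` (a printed-regular
history over the corner datum `X` — e.g. the corner's minimiser), `U₀ ∈ 𝔅_k(X₀)` printed-regular at `e₀` (the base's), and the data bondwise `β`-close.  Then there
is a RESIDUAL `w′` (print's (4)-element of the complete `k`-fold comb axial gauge relative to `U₀`, [Balaban1985Variational] (18)) such that `w′ • u` stays in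
`𝔘_k(ε₀) ∩ 𝔅_k(X)`, has plaquettes within `regThreshold F J K ε₀ = ε₀·L^{−2(K−J)}` of `1`, is axially aligned to `U₀` at every fine site (`rootOf` spelling of
✓`…CombTransporterAxialT` ∕ FILE F), and is within `113(ε₀ + e₀) + β` of `U₀` on EVERY bond ([Balaban1985RegularSpaces] Lemma 1 (1.25) «|V′ − 1| < 4d²α₀ + α₁»
at the carrier) — every constant independent of `k = K − J` and of the volume.  (= the `(w′, hW, hax, hclose)` block of FILE F's `qTube_of_axialAligned_gaugeAct`.)
[cite: Balaban1985RegularSpaces, Lemma 1 (1.24)-(1.25) p.79; Balaban1985Variational, (18) p.280] -/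
theorem closeAxiallyAlignedMin_of_regular (hL : 7 ≤ F.L) {ε₀ e₀ β : ℝ} (hβ : 0 ≤ β)
    (hε : 50 * (500 * (F.L : ℝ) + 7 * (F.L : ℝ) ^ 2) * ε₀ ≤ 1) (he : 50 * (500 * (F.L : ℝ) + 7 * (F.L : ℝ) ^ 2) * e₀ ≤ 1)
    {X X₀ : GaugeField (F.P J) 0 (Matrix.specialUnitaryGroup (Fin 2) ℂ)} {u U₀ : GaugeField (F.P K) 0 (Matrix.specialUnitaryGroup (Fin 2) ℂ)}
    (hu : u ∈ regFibrePr F J K hJK ε₀ X) (hU₀f : U₀ ∈ fibre F ℰp J K hJK X₀) (hU₀ : RegPr F J K e₀ U₀)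
    (hXX₀ : ∀ c' : PBond (F.P J) 0, dist1 (X c' * (X₀ c')⁻¹) ≤ β) :
    ∃ w' : residualSubgroup F hJK,
      GaugeField.gaugeAct (w' : Site (F.P K) 0 → Matrix.specialUnitaryGroup (Fin 2) ℂ) u ∈ regFibrePr F J K hJK ε₀ X ∧
      PlaqSmall (regThreshold F J K ε₀) (GaugeField.gaugeAct (w' : Site (F.P K) 0 → Matrix.specialUnitaryGroup (Fin 2) ℂ) u) ∧
      (∀ x : Site (F.P K) 0, axialT (GaugeField.gaugeAct (w' : Site (F.P K) 0 → Matrix.specialUnitaryGroup (Fin 2) ℂ) u) (rootOf (K - J) x) x =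
        axialT U₀ (rootOf (K - J) x) x) ∧
      ∀ b : PBond (F.P K) 0,
        dist1 (GaugeField.gaugeAct (w' : Site (F.P K) 0 → Matrix.specialUnitaryGroup (Fin 2) ℂ) u b * (U₀ b)⁻¹) ≤ 113 * (ε₀ + e₀) + β := by
  have he₀ : 0 < e₀ := pos_of_regPr F hU₀
  obtain ⟨v, hv, hmem, hax, -, -, -⟩ := exists_axial18 F hJK he₀.le U₀ u hU₀ hu
  refine ⟨⟨v, residual_of_descTransf_eq_one F hJK hv⟩, hmem, ((mem_regFibrePr_iff F).mp hmem).2.plaqSmall, ?_, ?_⟩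
  · intro x
    rw [rootOf_eq_embIter_iterBlockOf]
    exact hax x
  · intro b
    have hmid := dist1_iter_mul_inv_le_of_data F hJK ((mem_regFibrePr_iff F).mp hmem).1 hU₀f hXX₀
    have h := norm_pertVar_le_of_combAxial_T3 F hJK hL hβ hε he _ U₀ hmem hU₀ hax hmid b
    exact h

/-- ★★ **THE (β3) INSTANCE** — the corners of `DetRepB`'s window quadrilateral: data `X`, `X₀` with `PlaqSmall θ_X X`, `PlaqSmall θ₀ X₀` agreeing off ONE coarse bond
`c₀`; then CLOSE-AXIALLY-ALIGNED-MIN holds with `β := θ_X + θ₀`: `∀ b, dist1 ((w′ • u) b·(U₀ b)⁻¹) ≤ 113(ε₀ + e₀) + (θ_X + θ₀)`.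
[cite: Balaban1985RegularSpaces, Lemma 1 (1.24)-(1.25) p.79; Balaban1987RG1, (0.18) p.255] -/
theorem closeAxiallyAlignedMin_of_regular_offBond (hL : 7 ≤ F.L) {ε₀ e₀ θX θ₀ : ℝ}
    (hε : 50 * (500 * (F.L : ℝ) + 7 * (F.L : ℝ) ^ 2) * ε₀ ≤ 1) (he : 50 * (500 * (F.L : ℝ) + 7 * (F.L : ℝ) ^ 2) * e₀ ≤ 1)
    {X X₀ : GaugeField (F.P J) 0 (Matrix.specialUnitaryGroup (Fin 2) ℂ)} {u U₀ : GaugeField (F.P K) 0 (Matrix.specialUnitaryGroup (Fin 2) ℂ)}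
    (hu : u ∈ regFibrePr F J K hJK ε₀ X) (hU₀f : U₀ ∈ fibre F ℰp J K hJK X₀) (hU₀ : RegPr F J K e₀ U₀)
    (hX : PlaqSmall θX X) (hX₀ : PlaqSmall θ₀ X₀) (c₀ : PBond (F.P J) 0) (hagree : ∀ e : PBond (F.P J) 0, e ≠ c₀ → X e = X₀ e) :
    ∃ w' : residualSubgroup F hJK,
      GaugeField.gaugeAct (w' : Site (F.P K) 0 → Matrix.specialUnitaryGroup (Fin 2) ℂ) u ∈ regFibrePr F J K hJK ε₀ X ∧
      PlaqSmall (regThreshold F J K ε₀) (GaugeField.gaugeAct (w' : Site (F.P K) 0 → Matrix.specialUnitaryGroup (Fin 2) ℂ) u) ∧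
      (∀ x : Site (F.P K) 0, axialT (GaugeField.gaugeAct (w' : Site (F.P K) 0 → Matrix.specialUnitaryGroup (Fin 2) ℂ) u) (rootOf (K - J) x) x =
        axialT U₀ (rootOf (K - J) x) x) ∧
      ∀ b : PBond (F.P K) 0,
        dist1 (GaugeField.gaugeAct (w' : Site (F.P K) 0 → Matrix.specialUnitaryGroup (Fin 2) ℂ) u b * (U₀ b)⁻¹) ≤ 113 * (ε₀ + e₀) + (θX + θ₀) := by
  have hXX₀ := dist1_data_le_of_agree_off_bond F hX hX₀ c₀ hagree
  have hβ : 0 ≤ θX + θ₀ := (GaugeGroup.dist1_nonneg _).trans (hXX₀ c₀)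
  exact closeAxiallyAlignedMin_of_regular F hJK hL hβ hε he hu hU₀f hU₀ hXX₀

/-! ## §3 FILE F's Stokes surcharge at the regular radii is depth-free: `≤ (9∕2)(ε₀ + e₀)` -/

/-- ★ **THE THRESHOLD SURCHARGE OF FILE F AT THE CARRIER.**  With `d = 3` and the regular radii `δ = e·L^{−2(K−J)}`:
`2·((3(Lᵏ−1))²∕4)·(regThreshold ε₀ + regThreshold e₀) ≤ (9∕2)·(ε₀ + e₀)` (`(Lᵏ−1)²·L^{−2k} ≤ 1`), uniformly in `k = K − J`.
[cite: Balaban1985RegularSpaces, Lemma 1 (1.26) p.79; Balaban1985Averaging, (19)-(20) p.21] -/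
theorem stokesSurcharge_le {ε₀ e₀ : ℝ} (hε₀ : 0 ≤ ε₀) (he₀ : 0 ≤ e₀) :
    2 * ((((((F.P K).d * ((F.P K).L ^ (K - J) - 1) : ℕ) : ℝ)) ^ 2 / 4) * (regThreshold F J K ε₀ + regThreshold F J K e₀)) ≤
      9 / 2 * (ε₀ + e₀) := by
  have hL1 : (1 : ℝ) ≤ (F.L : ℝ) := by exact_mod_cast F.hL.2.le
  have hL0 : (0 : ℝ) < (F.L : ℝ) := by linarith
  have hd : (F.P K).d = 3 := T3Family.P_d F K
  have hLL : (F.P K).L = F.L := rfl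
  rw [hd, hLL]
  have hcast : (((3 * (F.L ^ (K - J) - 1) : ℕ) : ℝ)) ≤ 3 * (F.L : ℝ) ^ (K - J) := by
    have hsub : (F.L ^ (K - J) - 1 : ℕ) ≤ F.L ^ (K - J) := Nat.sub_le _ _
    have : (((3 * (F.L ^ (K - J) - 1) : ℕ) : ℝ)) ≤ ((3 * F.L ^ (K - J) : ℕ) : ℝ) := by
      exact_mod_cast Nat.mul_le_mul_left 3 hsub
    refine this.trans (le_of_eq ?_)
    push_cast; ring
  have h0 : (0 : ℝ) ≤ (((3 * (F.L ^ (K - J) - 1) : ℕ) : ℝ)) := Nat.cast_nonneg _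
  have hsq : (((3 * (F.L ^ (K - J) - 1) : ℕ) : ℝ)) ^ 2 ≤ 9 * (F.L : ℝ) ^ (2 * (K - J)) := by
    have := pow_le_pow_left₀ h0 hcast 2
    refine this.trans (le_of_eq ?_)
    rw [mul_pow, ← pow_mul, mul_comm (K - J) 2]; norm_num
  have hcancel : (F.L : ℝ) ^ (2 * (K - J)) * (((F.L : ℝ))⁻¹) ^ (2 * (K - J)) = 1 := by
    rw [← mul_pow, mul_inv_cancel₀ hL0.ne', one_pow]
  have hη : 0 ≤ (((F.L : ℝ))⁻¹) ^ (2 * (K - J)) := pow_nonneg (inv_nonneg.mpr hL0.le) _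
  have hsum : 0 ≤ ε₀ + e₀ := add_nonneg hε₀ he₀
  unfold regThreshold
  calc 2 * ((((3 * (F.L ^ (K - J) - 1) : ℕ) : ℝ)) ^ 2 / 4 * (ε₀ * ((F.L : ℝ)⁻¹) ^ (2 * (K - J)) + e₀ * ((F.L : ℝ)⁻¹) ^ (2 * (K - J))))
      = (1 / 2) * ((((3 * (F.L ^ (K - J) - 1) : ℕ) : ℝ)) ^ 2 * ((F.L : ℝ)⁻¹) ^ (2 * (K - J))) * (ε₀ + e₀) := by ring
    _ ≤ (1 / 2) * (9 * (F.L : ℝ) ^ (2 * (K - J)) * ((F.L : ℝ)⁻¹) ^ (2 * (K - J))) * (ε₀ + e₀) := by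
        apply mul_le_mul_of_nonneg_right _ hsum
        exact mul_le_mul_of_nonneg_left (mul_le_mul_of_nonneg_right hsq hη) (by norm_num)
    _ = 9 / 2 * (ε₀ + e₀) := by
        rw [mul_assoc 9, hcancel]; ring

/-- **FILE F's THREE THRESHOLDS FROM ONE NUMBER.**  If `t₀ := (235∕2)(ε₀ + e₀) + β` is below `r`, then so is FILE F's exact threshold quantity
`(113(ε₀ + e₀) + β) + 2·((d(Lᵏ−1))²∕4)·(regThreshold ε₀ + regThreshold e₀)` (by `stokesSurcharge_le`: `113 + 9∕2 = 235∕2`). [folklore] -/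
theorem threshold_le_of_stokesSurcharge {ε₀ e₀ β : ℝ} (hε₀ : 0 ≤ ε₀) (he₀ : 0 ≤ e₀) :
    113 * (ε₀ + e₀) + β +
        2 * ((((((F.P K).d * ((F.P K).L ^ (K - J) - 1) : ℕ) : ℝ)) ^ 2 / 4) * (regThreshold F J K ε₀ + regThreshold F J K e₀)) ≤
      235 / 2 * (ε₀ + e₀) + β := by
  have h := stokesSurcharge_le F (J := J) (K := K) hε₀ he₀
  linarith


/-! ## §4 (Q-TUBE) and the corner rows from a REGULAR CORNER — FILE F ∘ §2 -/

section WithFileF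

open MeasureTheory Filter Topology Set Function Metric
open Literature.MathematicalPhysics.QuantumFieldTheory.Balaban1983to89.HaarExponentialChart
open Literature.MathematicalPhysics.QuantumFieldTheory.Balaban1983to89.LogChartProduct
open Summit.QuantumFields.YangMills.Theorems.FluctuationComparisonRegPrIntLWregChain (iterCentralBond iterCentralBond_injective)
open Summit.QuantumFields.YangMills.Theorems.FluctuationComparisonRegPrIntLWregGlue (WindowChart)
open Summit.QuantumFields.YangMills.Theorems.FluctuationComparisonRegPrIntLS2BetaResidualSubgroup
open Summit.QuantumFields.YangMills.Theorems.FluctuationComparisonRegPrIntLS2BetaSignedComb (combTransporter)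
open Summit.QuantumFields.YangMills.Theorems.FluctuationComparisonRegPrIntLS2BetaSignedCombKill (combSet)
open Summit.QuantumFields.YangMills.Theorems.FluctuationComparisonRegPrIntLS2BetaCornerInTube (cornerRows_text_of_pivotAct_eq)
open Summit.QuantumFields.YangMills.Theorems.FluctuationComparisonRegPrIntLS2BetaQTubeOfAxialAligned (qTube_of_axialAligned_gaugeAct)

/-- ★★★ **(Q-TUBE) FROM A REGULAR CORNER — the EDGE third's kinematic letter DISCHARGED modulo the cover row (F6) and regularity of the two histories.**  Block size
`L ≥ 7`; radii `ε₀, e₀` with `50(500L + 7L²)·e ≤ 1`; `u ∈ 𝔘_k(ε₀) ∩ 𝔅_k(X)` (the corner's regular history), `U₀ ∈ 𝔅_k(X₀)` printed-regular at `e₀` (the base, through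
which the tube of record `⟨σ, UV⟩` with its cover row `hF6` passes), data bondwise `β`-close, and ONE number `t₀ := (235∕2)(ε₀ + e₀) + β` below the fixed chart
thresholds (`< r_C`, `≤ ½`, `2t₀ < s_C∕2` — depth-free; the organ's `ε₁`, `γ₁`) ⟹ `∃ k y, y ∈ UV ∧ pivotAct ι k (σ y) = u`.
= FILE F ★★★`qTube_of_axialAligned_gaugeAct` ∘ ★★★`closeAxiallyAlignedMin_of_regular` ∘ `threshold_le_of_stokesSurcharge`.
[cite: Balaban1985RegularSpaces, Lemma 1 (1.24)-(1.26) p.79; Balaban1985Variational, (18) p.280, Thm 1 (8)-(10) p.279; Balaban1985Averaging, pp.24-25] -/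
theorem qTube_of_regularCorner (hL : 7 ≤ F.L) {ε₀ e₀ β : ℝ} (hβ : 0 ≤ β)
    (hε : 50 * (500 * (F.L : ℝ) + 7 * (F.L : ℝ) ^ 2) * ε₀ ≤ 1) (he : 50 * (500 * (F.L : ℝ) + 7 * (F.L : ℝ) ^ 2) * e₀ ≤ 1)
    {dV : ℕ} {U₀ : GaugeField (F.P K) 0 (Matrix.specialUnitaryGroup (Fin 2) ℂ)}
    {σ : EuclideanSpace ℝ (Fin dV) → GaugeField (F.P K) 0 (Matrix.specialUnitaryGroup (Fin 2) ℂ)}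
    {UV : Set (EuclideanSpace ℝ (Fin dV))}
    (hF6 : ∀ V' : GaugeField (F.P K) 0 (Matrix.specialUnitaryGroup (Fin 2) ℂ),
        (∀ (b : PBond (F.P K) 0) (hb : b ∉ (combSet (K - J) : Set (PBond (F.P K) 0)) ∪ Set.range (iterCentralBond (P := F.P K) (K - J))),
          (combTransporter (K - J) U₀ b.src * U₀ b * (combTransporter (K - J) U₀ b.tgt)⁻¹)⁻¹ *
              (combTransporter (K - J) V' b.src * V' b * (combTransporter (K - J) V' b.tgt)⁻¹) ∈
            (isChartRep_specialUnitaryGroup (n := Fin 2)).window (IsChartRep.chartRadius (specialUnitaryLogChart (Fin 2)) / 2)) →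
        ∃ y ∈ UV, ∃ w : residualSubgroup F hJK,
          (w : Site (F.P K) 0 → Matrix.specialUnitaryGroup (Fin 2) ℂ) = (fun x => (combTransporter (K - J) V' x)⁻¹ * combTransporter (K - J) U₀ x) ∧
          V' = pivotAct F hJK (iterCentralBond (P := F.P K) (K - J))
            (w, fun c => V' (iterCentralBond (P := F.P K) (K - J) c) * (U₀ (iterCentralBond (P := F.P K) (K - J) c))⁻¹) (σ y))
    {X X₀ : GaugeField (F.P J) 0 (Matrix.specialUnitaryGroup (Fin 2) ℂ)} {u : GaugeField (F.P K) 0 (Matrix.specialUnitaryGroup (Fin 2) ℂ)}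
    (hu : u ∈ regFibrePr F J K hJK ε₀ X) (hU₀f : U₀ ∈ fibre F ℰp J K hJK X₀) (hU₀ : RegPr F J K e₀ U₀)
    (hXX₀ : ∀ c' : PBond (F.P J) 0, dist1 (X c' * (X₀ c')⁻¹) ≤ β)
    (ht₁ : 235 / 2 * (ε₀ + e₀) + β < IsChartRep.innerRadius (specialUnitaryLogChart (Fin 2)))
    (ht₂ : 235 / 2 * (ε₀ + e₀) + β ≤ 1 / 2)
    (ht₃ : 2 * (235 / 2 * (ε₀ + e₀) + β) < IsChartRep.chartRadius (specialUnitaryLogChart (Fin 2)) / 2) :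
    ∃ (k : ↥(residualSubgroup F hJK) × (PBond (F.P K) (K - J) → Matrix.specialUnitaryGroup (Fin 2) ℂ)) (y : EuclideanSpace ℝ (Fin dV)),
      y ∈ UV ∧ pivotAct F hJK (iterCentralBond (P := F.P K) (K - J)) k (σ y) = u := by
  have hk : K - J ≤ (F.P K).m + (F.P K).K := by show K - J ≤ F.m + K; omega
  have hε₀ : 0 < ε₀ := pos_of_regPr F ((mem_regFibrePr_iff F).mp hu).2
  have he₀ : 0 < e₀ := pos_of_regPr F hU₀
  obtain ⟨w', -, hpl, hax, hclose⟩ := closeAxiallyAlignedMin_of_regular F hJK hL hβ hε he hu hU₀f hU₀ hXX₀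
  have hsur := threshold_le_of_stokesSurcharge F (J := J) (K := K) (β := β) hε₀.le he₀.le
  have hr0 : 0 ≤ regThreshold F J K ε₀ := by unfold regThreshold; positivity
  have hr1 : 0 ≤ regThreshold F J K e₀ := by unfold regThreshold; positivity
  exact qTube_of_axialAligned_gaugeAct F hJK hk hF6 w' hr0 hr1 hpl hU₀.plaqSmall hax (fun b _ => hclose b)
    (lt_of_le_of_lt hsur ht₁) (hsur.trans ht₂) (by linarith)

/-- ★★★ **THE CORNER ROWS OF `EdgeRows` FROM A REGULAR CORNER** (FILE F's `cornerRows_text_of_axialAlignedClose` with CLOSE-AXIALLY-ALIGNED-MIN discharged):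
= ★★★`qTube_of_regularCorner` then ✓`cornerRows_text_of_pivotAct_eq`.  Remaining displayed letters: the tube of record's cover row `hF6` + positivity `hjV`, the window
chart rows at `X`, the live minimising history `u` (EXW∘) with its printed regularity, the base's regularity, the data closeness, one depth-free number below the chart
thresholds. [cite: Balaban1985Variational, Thm 1 (8)-(10) p.279; Balaban1985RegularSpaces, Lemma 1 (1.25) p.79; Balaban1985Averaging, §E Prop 6 p.26-27] -/
theorem cornerRows_text_of_regularCorner (hL : 7 ≤ F.L) {ε₀ e₀ β : ℝ} (hβ : 0 ≤ β)
    (hε : 50 * (500 * (F.L : ℝ) + 7 * (F.L : ℝ) ^ 2) * ε₀ ≤ 1) (he : 50 * (500 * (F.L : ℝ) + 7 * (F.L : ℝ) ^ 2) * e₀ ≤ 1)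
    {Sf : Set (GaugeField (F.P K) 0 (Matrix.specialUnitaryGroup (Fin 2) ℂ))} {O : Set (GaugeField (F.P J) 0 (Matrix.specialUnitaryGroup (Fin 2) ℂ))}
    (c : WindowChart F hJK Sf O) (m : GaugeField (F.P J) 0 (Matrix.specialUnitaryGroup (Fin 2) ℂ) → ℝ)
    {X X₀ : GaugeField (F.P J) 0 (Matrix.specialUnitaryGroup (Fin 2) ℂ)} {u : GaugeField (F.P K) 0 (Matrix.specialUnitaryGroup (Fin 2) ℂ)}
    (hum : u ∈ fibre F ℰp J K hJK X ∧ u ∈ Sf ∧ wilsonAction4 u = m X)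
    (hcarr : ∀ k z, z ∈ {z : GaugeField (F.P K) 0 (Matrix.specialUnitaryGroup (Fin 2) ℂ) | c.jac (X, z) ≠ 0} →
      pivotAct F hJK (iterCentralBond (P := F.P K) (K - J)) k z ∈ {z : GaugeField (F.P K) 0 (Matrix.specialUnitaryGroup (Fin 2) ℂ) | c.jac (X, z) ≠ 0})
    (hAinv : ∀ k, ∀ z ∈ {z : GaugeField (F.P K) 0 (Matrix.specialUnitaryGroup (Fin 2) ℂ) | c.jac (X, z) ≠ 0},
      wilsonAction4 (c.Φ (X, pivotAct F hJK (iterCentralBond (P := F.P K) (K - J)) k z)) = wilsonAction4 (c.Φ (X, z)))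
    (hSinv : ∀ k, ∀ z ∈ {z : GaugeField (F.P K) 0 (Matrix.specialUnitaryGroup (Fin 2) ℂ) | c.jac (X, z) ≠ 0},
      c.Φ (X, z) ∈ Sf → c.Φ (X, pivotAct F hJK (iterCentralBond (P := F.P K) (K - J)) k z) ∈ Sf)
    (hrec : ∀ U, descendTo F ℰp J K hJK U = X → U ∈ Sf → (c.jac (X, U) ≠ 0 ∧ c.Φ (X, U) = U) ∧
      {z : GaugeField (F.P K) 0 (Matrix.specialUnitaryGroup (Fin 2) ℂ) | c.jac (X, z) ≠ 0} ∈ 𝓝 U)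
    {dV : ℕ} {U₀ : GaugeField (F.P K) 0 (Matrix.specialUnitaryGroup (Fin 2) ℂ)}
    {σ : EuclideanSpace ℝ (Fin dV) → GaugeField (F.P K) 0 (Matrix.specialUnitaryGroup (Fin 2) ℂ)} (hσ : Continuous σ)
    {UV : Set (EuclideanSpace ℝ (Fin dV))} {jV : EuclideanSpace ℝ (Fin dV) → ℝ} (hjV : ∀ y ∈ UV, 0 < jV y)
    (hF6 : ∀ V' : GaugeField (F.P K) 0 (Matrix.specialUnitaryGroup (Fin 2) ℂ),
        (∀ (b : PBond (F.P K) 0) (hb : b ∉ (combSet (K - J) : Set (PBond (F.P K) 0)) ∪ Set.range (iterCentralBond (P := F.P K) (K - J))),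
          (combTransporter (K - J) U₀ b.src * U₀ b * (combTransporter (K - J) U₀ b.tgt)⁻¹)⁻¹ *
              (combTransporter (K - J) V' b.src * V' b * (combTransporter (K - J) V' b.tgt)⁻¹) ∈
            (isChartRep_specialUnitaryGroup (n := Fin 2)).window (IsChartRep.chartRadius (specialUnitaryLogChart (Fin 2)) / 2)) →
        ∃ y ∈ UV, ∃ w : residualSubgroup F hJK,
          (w : Site (F.P K) 0 → Matrix.specialUnitaryGroup (Fin 2) ℂ) = (fun x => (combTransporter (K - J) V' x)⁻¹ * combTransporter (K - J) U₀ x) ∧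
          V' = pivotAct F hJK (iterCentralBond (P := F.P K) (K - J))
            (w, fun c => V' (iterCentralBond (P := F.P K) (K - J) c) * (U₀ (iterCentralBond (P := F.P K) (K - J) c))⁻¹) (σ y))
    (hu : RegPr F J K ε₀ u) (hU₀f : U₀ ∈ fibre F ℰp J K hJK X₀) (hU₀ : RegPr F J K e₀ U₀)
    (hXX₀ : ∀ c' : PBond (F.P J) 0, dist1 (X c' * (X₀ c')⁻¹) ≤ β)
    (ht₁ : 235 / 2 * (ε₀ + e₀) + β < IsChartRep.innerRadius (specialUnitaryLogChart (Fin 2)))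
    (ht₂ : 235 / 2 * (ε₀ + e₀) + β ≤ 1 / 2)
    (ht₃ : 2 * (235 / 2 * (ε₀ + e₀) + β) < IsChartRep.chartRadius (specialUnitaryLogChart (Fin 2)) / 2) :
    ∃ y : EuclideanSpace ℝ (Fin dV),
      y ∈ UV ∧ 0 < jV y ∧ (∀ᶠ v in 𝓝 y, c.jac (X, σ v) ≠ 0) ∧ c.Φ (X, σ y) ∈ Sf ∧ wilsonAction4 (c.Φ (X, σ y)) = m X := by
  have hk : K - J ≤ (F.P K).m + (F.P K).K := by show K - J ≤ F.m + K; omega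
  have hu' : u ∈ regFibrePr F J K hJK ε₀ X := (mem_regFibrePr_iff F).mpr ⟨hum.1, hu⟩
  obtain ⟨k, y, hy, hΘ⟩ := qTube_of_regularCorner F hJK hL hβ hε he hF6 hu' hU₀f hU₀ hXX₀ ht₁ ht₂ ht₃
  exact ⟨y, cornerRows_text_of_pivotAct_eq F hJK hk c m hum hcarr hAinv hSinv hrec hσ hΘ hy (hjV y hy)⟩

end WithFileF

end Summit.QuantumFields.YangMills.Theorems.FluctuationComparisonRegPrIntLS2BetaCloseAxiallyAlignedMin

end
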